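import Summits.ResolutionOfSingularities.ResolutionOfSingularities.Theorems.MarkedTransferCampaignW24ReducedRunListEval
import Summits.ResolutionOfSingularities.ResolutionOfSingularities.Theorems.MarkedTransferCampaignW24ReducedRunRenormCycle
import HarnessLib

/-!
# AN IMMORTAL UNIVERSAL RUN AT `p = 7` — the polynomial `1 + 4t + 6t²` (and the carrier `5t + 6t² + 5t³ + 5t⁴ + 2t⁵`) over any
# field of characteristic 7: the universal reduced Case-(I) run NEVER DIES and visits every boundary digit `7^a − 1`
# (HIRONAKA-L, kernel certificate in the OURS reduced model of slot W2.4 / RD-2′ (`CampaignW24.ReducedRun`); res-type-059 g14;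
# uses `…ReducedRunListEval.lean` (digit-list evaluator) and `…ReducedRunRenormCycle.lean` (immortality criterion))

**HONEST FRAMING.** OURS throughout: kernel theorems about the one-variable reduced model (`univRun` of
`MarkedTransferCampaignW24ReducedRunUniversal.lean`, res-D-pv-035 AS res-L1-k24). Nothing below is a statement of [Hironaka2017]
(lit key `paper:url-3343fd9e678b`), nothing asserts that any statement of it holds, nothing is a claim about resolution of
singularities in characteristic `p`; the manuscript stays «under review» (D-0012/D-0089). AI work, weaker than expert review.

**What this records (OURS objects only).** res-rescue-typ-2's residual for the `v = 1` reduced slice of ⟨`FiniteSupportStaysInBox_ours`⟩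
was «the universal run of every polynomial dies» (FINDING 2026-08-27T10:21:26Z); at `p = 2` that is a TREE THEOREM
(`univRun_eventually_zero`, res-L1-type-o6, `…ReducedRunDeath.lean`). THIS FILE: at `p = 7` the same sentence is FALSE —
`univRun_ne_zero_seven`: the universal run from `1 + 4t + 6t²` never reaches `0` (over every field of characteristic 7), and
`univRun_ne_zero_carrier_seven`: neither does the run from the carrier `5t + 6t² + 5t³ + 5t⁴ + 2t⁵` (`g₀(0) = 0`, one of the two
IMMORTAL classes of the exact census kit j277782, `p = 7`, `deg ≤ 5`). At the same time `order_univRun_seven`: the run from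
`1 + 4t + 6t²` has bottom digit `7^{a+1} − 1` at state `6(a + 1)` for EVERY `a` — it visits every boundary digit, so by
`canonRun_succ_eq_zero_of_univDigit` its canonical depth-`7^{a+1}` runs are all exhausted in box (`canonRun_seven_eq_zero`:
`canonRun 7^{a+1} S (6a+7) = 0`): death of the universal run is sufficient, not necessary, for all-depth exhaustion. So «UnivRunDies» is `p`-DEPENDENT as typed. Certificate: six explicit list
steps (`runOK … = true`, `decide +kernel`), the state at index 6 has bottom digit `6 = 7 − 1` and contracted bottom class
`5·S(4u)` — the hypothesis of `univRun_ne_zero_of_cycle`.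
General glue first (`univRun_ne_zero_of_listCycle`, `order_univRun_of_listCycle`, any prime): immortality / digits from a
LIST CERTIFICATE whose every hypothesis is decidable on the data — so the other IMMORTAL classes of the census are one `decide`
away. Hypotheses: none beyond `[CharP K p]`; no FACT-LIST fact, no DEFECT binder; no new definitions. Standard axioms.
-/

noncomputable section

set_option linter.dupNamespace false -- mandated namespace of this single-conjunct summit

namespace Summit.ResolutionOfSingularities.ResolutionOfSingularities.Theorems

namespace CampaignW24

namespace ReducedRun

open PowerSeries

universe u

/-! ## From a list certificate to immortality (any prime) -/

section ListCycle

variable {K : Type u} [Field K] (p : ℕ) [hp : Fact p.Prime] [CharP K p]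

omit hp in
/-- A residue `c` with `c % p ≠ 0` is non-zero in `K`. [folklore] -/
theorem natCast_ne_zero_of_mod {c : ℕ} (hc : c % p ≠ 0) : (c : K) ≠ 0 := by
  rw [Ne, CharP.cast_eq_zero_iff K p]
  exact fun h => hc (Nat.mod_eq_zero_of_dvd h)

/-- **IMMORTALITY FROM A LIST CERTIFICATE (any prime `p`).** If the list run from `S` along `steps` is legal (`runOK`), ends at
a list `G` whose bottom index is `q·j₀ + (q−1)` (`q = p^a`), and the finite check `c·l^r·S_r ≡ G_{q r + q − 1}` (`r < R`, with the
length bounds) holds for residues `c, l ≢ 0`, then the universal run from `ofList S` never dies. Every hypothesis is decidable on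
the data (`decide` / `decide +kernel`). [folklore] -/
theorem univRun_ne_zero_of_listCycle {fuel a j₀ c l R : ℕ} {S : List ℕ} {steps : List (ℕ × ℕ)}
    (hsteps : 0 < steps.length) (hrun : runOK p fuel S steps = true)
    (hord : (∀ m < p ^ a * j₀ + (p ^ a - 1), lget (lrunWith p fuel S steps) m % p = 0) ∧
      lget (lrunWith p fuel S steps) (p ^ a * j₀ + (p ^ a - 1)) % p ≠ 0)
    (hc : c % p ≠ 0) (hl : l % p ≠ 0) (hA : (lrunWith p fuel S steps).length ≤ p ^ a * R + (p ^ a - 1))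
    (hS : S.length ≤ R)
    (hcyc : ∀ r < R, c * l ^ r * lget S r % p = lget (lrunWith p fuel S steps) (p ^ a * r + (p ^ a - 1)) % p) :
    ∀ n : ℕ, univRun (ofList S : K⟦X⟧) n ≠ 0 :=
  univRun_ne_zero_of_cycle p (natCast_ne_zero_of_mod p hc) (natCast_ne_zero_of_mod p hl) hsteps
    (univRun_ofList p steps S hrun) (order_ofList p hord.1 hord.2) (coeff_C_mul_rescale_ofList p hA hS hcyc)

/-- **DIGITS FROM A LIST CERTIFICATE.** In the same situation, if the run from `ofList S` has bottom digit `κ` at state `m`,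
it has bottom digit `q·κ + (q−1)` at state `steps.length + m`. [folklore] -/
theorem order_univRun_of_listCycle {fuel a j₀ c l R : ℕ} {S : List ℕ} {steps : List (ℕ × ℕ)}
    (hrun : runOK p fuel S steps = true)
    (hord : (∀ m < p ^ a * j₀ + (p ^ a - 1), lget (lrunWith p fuel S steps) m % p = 0) ∧
      lget (lrunWith p fuel S steps) (p ^ a * j₀ + (p ^ a - 1)) % p ≠ 0)
    (hc : c % p ≠ 0) (hl : l % p ≠ 0) (hA : (lrunWith p fuel S steps).length ≤ p ^ a * R + (p ^ a - 1))
    (hS : S.length ≤ R)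
    (hcyc : ∀ r < R, c * l ^ r * lget S r % p = lget (lrunWith p fuel S steps) (p ^ a * r + (p ^ a - 1)) % p)
    (m : ℕ) {κ : ℕ} (hκ : order (univRun (ofList S : K⟦X⟧) m) = κ) :
    order (univRun (ofList S : K⟦X⟧) (steps.length + m)) = (p ^ a * κ + (p ^ a - 1) : ℕ) :=
  order_univRun_of_cycle p (natCast_ne_zero_of_mod p hc) (natCast_ne_zero_of_mod p hl)
    (univRun_ofList p steps S hrun) (order_ofList p hord.1 hord.2) (coeff_C_mul_rescale_ofList p hA hS hcyc) m hκ

end ListCycle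

section Seven

variable {K : Type u} [Field K] [CharP K 7]

/-- **Six certified states.** The universal run from `S = 1 + 4t + 6t²` for six steps is the list run with bottom indices
`0,1,2,3,4,5` and inverses `1,5,4,2,4,2` (all side conditions by `decide`). [folklore] -/
theorem univRun_seven_six :
    univRun (ofList [1, 4, 6] : K⟦X⟧) 6 =
      ofList (lrunWith 7 3 [1, 4, 6] [(0, 1), (1, 5), (2, 4), (3, 2), (4, 4), (5, 2)]) := by
  haveI : Fact (Nat.Prime 7) := ⟨by norm_num⟩
  exact univRun_ofList 7 (fuel := 3) [(0, 1), (1, 5), (2, 4), (3, 2), (4, 4), (5, 2)] [1, 4, 6] (by decide +kernel)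

/-- **State 6 sits at the boundary digit `6 = 7 − 1`.** [folklore] -/
theorem order_univRun_seven_six : order (univRun (ofList [1, 4, 6] : K⟦X⟧) 6) = (7 ^ 1 * 0 + (7 ^ 1 - 1) : ℕ) := by
  rw [univRun_seven_six, show (7 ^ 1 * 0 + (7 ^ 1 - 1) : ℕ) = 6 by norm_num]
  exact order_ofList (K := K) 7 (by decide +kernel) (by decide +kernel)

/-- **The contracted bottom class of state 6 is `5 · S(4u)`** — the renormalised state recurs up to the symmetries
(`c = 5`, `λ = 4`). [folklore] -/
theorem cycle_seven (r : ℕ) :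
    coeff r (C ((5 : ℕ) : K) * rescale ((4 : ℕ) : K) (ofList [1, 4, 6])) =
      coeff (7 ^ 1 * r + (7 ^ 1 - 1)) (univRun (ofList [1, 4, 6] : K⟦X⟧) 6) := by
  rw [univRun_seven_six]
  exact coeff_C_mul_rescale_ofList (K := K) 7 (R := 19) (by decide +kernel) (by decide +kernel) (by decide +kernel) r

/-- **IMMORTALITY AT `p = 7`.** Over every field of characteristic `7`, the universal reduced Case-(I) run from
`1 + 4t + 6t²` never dies: `univRun (1 + 4t + 6t²) n ≠ 0` for all `n`. OURS (reduced model). [folklore] -/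
theorem univRun_ne_zero_seven (n : ℕ) : univRun (ofList [1, 4, 6] : K⟦X⟧) n ≠ 0 := by
  haveI : Fact (Nat.Prime 7) := ⟨by norm_num⟩
  have h5 : ((5 : ℕ) : K) ≠ 0 := by rw [Ne, CharP.cast_eq_zero_iff K 7]; decide
  have h4 : ((4 : ℕ) : K) ≠ 0 := by rw [Ne, CharP.cast_eq_zero_iff K 7]; decide
  exact univRun_ne_zero_of_cycle 7 h5 h4 (by norm_num) rfl order_univRun_seven_six cycle_seven n

/-- **EVERY BOUNDARY DIGIT IS VISITED.** The run from `1 + 4t + 6t²` has bottom digit `7^{a+1} − 1` at state `6(a + 1)`, for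
every `a` (self-similarity, `order_univRun_of_cycle`; digits `0,1,…,6, 13,20,…,48, 97,…,342, …`). [folklore] -/
theorem order_univRun_seven : ∀ a : ℕ, order (univRun (ofList [1, 4, 6] : K⟦X⟧) (6 * a + 6)) = (7 ^ (a + 1) - 1 : ℕ)
  | 0 => by
    rw [show 6 * 0 + 6 = 6 by norm_num, order_univRun_seven_six]
    norm_num
  | a + 1 => by
    haveI : Fact (Nat.Prime 7) := ⟨by norm_num⟩
    have h5 : ((5 : ℕ) : K) ≠ 0 := by rw [Ne, CharP.cast_eq_zero_iff K 7]; decide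
    have h4 : ((4 : ℕ) : K) ≠ 0 := by rw [Ne, CharP.cast_eq_zero_iff K 7]; decide
    have ih := order_univRun_seven a
    have h := order_univRun_of_cycle 7 h5 h4 rfl order_univRun_seven_six cycle_seven (6 * a + 6) ih
    rw [show 6 * (a + 1) + 6 = 6 + (6 * a + 6) by ring, h]
    congr 1
    have : 1 ≤ 7 ^ (a + 1) := Nat.one_le_pow _ _ (by norm_num)
    rw [pow_succ 7 (a + 1)]
    omega

/-- **… YET EXHAUSTED IN BOX AT EVERY DEPTH.** The canonical depth-`7^{a+1}` reduced run from `1 + 4t + 6t²` is EXHAUSTED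
(exactly `0`) at state `6a + 7`, for every `a` (`canonRun_succ_eq_zero_of_univDigit` at the boundary digit of
`order_univRun_seven`; the earlier states are in the box because digits rise, `order_univRun_lt_of_lt`). Death of the universal
run is sufficient, not necessary, for exhaustion at all depths. OURS (reduced model). [folklore] -/
theorem canonRun_seven_eq_zero (a : ℕ) : canonRun (7 ^ (a + 1)) (ofList [1, 4, 6] : K⟦X⟧) (6 * a + 6 + 1) = 0 := by
  haveI : Fact (Nat.Prime 7) := ⟨by norm_num⟩
  refine canonRun_succ_eq_zero_of_univDigit 7 (EqBelow.refl _) (6 * a + 6) (fun j hj => ?_) (order_univRun_seven a)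
  obtain ⟨k, hk⟩ := exists_order_eq_nat (univRun_ne_zero_seven (K := K) j)
  refine ⟨k, hk, ?_⟩
  have hlt := order_univRun_lt_of_lt 7 (ofList [1, 4, 6] : K⟦X⟧) hj (univRun_ne_zero_seven _)
  rw [hk, order_univRun_seven a, Nat.cast_lt] at hlt
  omega

/-- **Four certified states of the carrier.** The universal run from `T = 5t + 6t² + 5t³ + 5t⁴ + 2t⁵` for four steps (bottom
indices `1,2,4,5`, inverses `3,4,6,4`). [folklore] -/
theorem univRun_carrier_seven_four :
    univRun (ofList [0, 5, 6, 5, 5, 2] : K⟦X⟧) 4 =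
      ofList (lrunWith 7 3 [0, 5, 6, 5, 5, 2] [(1, 3), (2, 4), (4, 6), (5, 4)]) := by
  haveI : Fact (Nat.Prime 7) := ⟨by norm_num⟩
  exact univRun_ofList 7 (fuel := 3) [(1, 3), (2, 4), (4, 6), (5, 4)] [0, 5, 6, 5, 5, 2] (by decide +kernel)

/-- **State 4 of the carrier sits at the boundary digit `6`.** [folklore] -/
theorem order_univRun_carrier_seven_four :
    order (univRun (ofList [0, 5, 6, 5, 5, 2] : K⟦X⟧) 4) = (7 ^ 1 * 0 + (7 ^ 1 - 1) : ℕ) := by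
  rw [univRun_carrier_seven_four, show (7 ^ 1 * 0 + (7 ^ 1 - 1) : ℕ) = 6 by norm_num]
  exact order_ofList (K := K) 7 (by decide +kernel) (by decide +kernel)

/-- **Its contracted bottom class is exactly `S = 1 + 4t + 6t²`.** [folklore] -/
theorem contract_carrier_seven (r : ℕ) :
    coeff r (ofList [1, 4, 6] : K⟦X⟧) = coeff (7 ^ 1 * r + (7 ^ 1 - 1)) (univRun (ofList [0, 5, 6, 5, 5, 2] : K⟦X⟧) 4) := by
  rw [univRun_carrier_seven_four]
  exact coeff_ofList_eq_of_check (K := K) 7 (R := 9) (by decide +kernel) (by decide +kernel) (by decide +kernel) r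

/-- **IMMORTALITY OF THE CARRIER.** Over every field of characteristic `7`, the universal reduced Case-(I) run from the carrier
`5t + 6t² + 5t³ + 5t⁴ + 2t⁵` (constant term `0`) never dies. With res-L1-type-o6's `univRun_eventually_zero` (`p = 2`: every
polynomial run dies) this makes «the universal run of every polynomial dies» a `p`-dependent sentence. OURS (reduced model).
[folklore] -/
theorem univRun_ne_zero_carrier_seven (n : ℕ) : univRun (ofList [0, 5, 6, 5, 5, 2] : K⟦X⟧) n ≠ 0 := by
  haveI : Fact (Nat.Prime 7) := ⟨by norm_num⟩
  intro hn
  have hG0 : univRun (ofList [0, 5, 6, 5, 5, 2] : K⟦X⟧) 4 ≠ 0 := fun h => by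
    have := (order_eq_nat.mp (order_univRun_carrier_seven_four (K := K))).1
    rw [h, map_zero] at this
    exact this rfl
  by_cases hle : n ≤ 4
  · exact hG0 (univRun_eq_zero_of_le _ hn hle)
  · obtain ⟨m, rfl⟩ := Nat.exists_eq_add_of_lt (lt_of_not_ge hle)
    have hm : univRun (univRun (ofList [0, 5, 6, 5, 5, 2] : K⟦X⟧) 4) (m + 1) = 0 := by
      rw [← univRun_add, ← add_assoc, hn]
    rw [univRun_eq_zero_iff 7 order_univRun_carrier_seven_four (fun r => (contract_carrier_seven r)) (m + 1)] at hm
    exact univRun_ne_zero_seven (m + 1) hm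

end Seven

end ReducedRun

end CampaignW24

end Summit.ResolutionOfSingularities.ResolutionOfSingularities.Theorems

end
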